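import Literature.NumberTheory.EllipticCurves.BinaryQuarticCongruenceEnvelopesProofs
import Literature.MeasureTheory.Group.PadicIntHaar
import Mathlib.Data.ZMod.QuotientRing
import HarnessLib

/-!
# Congruence averages: `∫_{V_{ℤ_p}} ψ dμ_p = p^{-5n} Σ_{r mod pⁿ} ψ(r)` for a level-`n` weight, and
# the Chinese-remainder product formula `N⁻⁵ Σ_{r mod N} ∏_p ψ_p(r) = ∏_p p^{-5n_p} Σ ψ_p`

`Proofs` companion (theorems only: no definitions, no named facts) of `BinaryQuarticMeasure.lean`
(the normalised measure `μ_p` on `V_{ℤ_p} = BinaryQuartic ℤ_[p]`) and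
`BinaryQuarticCongruenceEnvelopesProofs.lean` (the congruence classes
`C_n(f) = {g : g ≡ f (mod pⁿ)}` and the level-`n` envelopes `ψ_{p,n}`, `ψ'_{p,n}` of a local
weight, which are constant on these classes).

Source: M. Bhargava, A. Shankar, *Binary quartic forms having bounded invariants, and the
boundedness of the average rank of elliptic curves*, Ann. of Math. (2) 181 (2015) 191–242.
In the congruence version of the counting theorem (Thm 2.11 of the held text `arXiv:1006.1002v2`,
§2.5, p. 13; Thm 2.12 of the published version) a set `S ⊂ V_ℤ` "defined by congruence
conditions modulo some integer `m`" is "the union of (say) `k` translates `𝓛₁, …, 𝓛_k` of the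
lattice `m · V_ℤ`", the count is `k · Vol/(nᵢ m⁵) + O(…)`, and the theorem
`N(S ∩ V_ℤ^{(i)}; X) = N(V_ℤ^{(i)}; X) ∏_p μ_p(S) + O(X^{3/4+ε})` "follows from Equations (14) and
(21), together with the identity `k m⁻⁵ = ∏_p μ_p(S)`". In the sieve (published version, proof
of Thm 2.21) the same is applied to the weight `∏_{p<Y} ψ_{p}(f)` built from level-`n_p` functions
`ψ_p` on `V_{ℤ_p}`, whose average modulo `N = ∏_{p<Y} p^{n_p}` must be identified with
`∏_{p<Y} ∫_{V_{ℤ_p}} ψ_p dμ_p`. This file proves these two identities (everything PROVED):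

* §1 `volume_pi_setOf_toZModPow_eq`, `volume_setOf_congr`: a congruence class modulo `pⁿ` in
  `ℤ_p^d` has Haar measure `p^{-dn}`; in `V_{ℤ_p}`, `μ_p(C_n(f)) = p^{-5n}`.
* §2 **`integral_comp_toZModPow_eq`** (on `ℤ_p^d`) and **`integral_comp_coeffs_toZModPow_eq`**
  (on `V_{ℤ_p}`): for any `G` on `(ℤ/pⁿℤ)^d`,
  `∫ G(x mod pⁿ) dμ_p(x) = p^{-dn} Σ_{r ∈ (ℤ/pⁿℤ)^d} G(r)`; hence (`integral_eq_of_congr_invariant`)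
  for a weight `ψ` on `V_{ℤ_p}` constant on the classes `C_n`,
  `∫_{V_{ℤ_p}} ψ dμ_p = p^{-5n} Σ_{r ∈ (ℤ/pⁿℤ)⁵} ψ(r̃)`, `r̃` the form with coefficients the
  standard lifts of `r` — "`μ_p(S)` = (number of classes in `S`)/`p^{5n}`" for `ψ = 1_S`.
* §3 **`sum_prod_comp_castHom_eq_prod_sum`** (Chinese remainder): for pairwise coprime moduli
  `a_i` with `N = ∏ a_i` and functions `G_i` on `(ℤ/a_iℤ)^d`,
  `Σ_{r ∈ (ℤ/Nℤ)^d} ∏_i G_i(r mod a_i) = ∏_i Σ_{s ∈ (ℤ/a_iℤ)^d} G_i(s)`, and the normalised form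
  `N^{-d} Σ_r ∏_i G_i(r mod a_i) = ∏_i (a_i^{-d} Σ_s G_i(s))`
  (`density_prod_comp_castHom_eq_prod_density`) — the identity "`k m⁻⁵ = ∏_p μ_p(S)`".
* §4 glue for integral forms: `(f ⊗ ℤ_p) mod pⁿ = f mod pⁿ` and `(f mod N) mod pⁿ = f mod pⁿ`
  coefficientwise (`toZModPow_coeffs_map_intCast`, `castHom_intCast_coeffs`), so that the weight
  `f ↦ ∏_p ψ_p(f ⊗ ℤ_p)` on `V_ℤ` is the pull-back of `r ↦ ∏_p G_p(r mod p^{n_p})` on `(ℤ/Nℤ)⁵`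
  (`prod_weight_map_intCast_eq`).

## References

* M. Bhargava, A. Shankar, Ann. of Math. (2) 181 (2015) 191–242 = arXiv:1006.1002, §2.5,
  Thm 2.11 and its proof ("the identity `k m⁻⁵ = ∏_p μ_p(S)`"; arXiv v2 numbering), and §2.7
  of the published version (proof of Thm 2.21). [cite: BhargavaShankarAnnals2015, §2.5 Thm 2.11 and its proof (arXiv:1006.1002v2 numbering)]
-/

noncomputable section

open scoped Classical ENNReal
open Set MeasureTheory Finset Function

namespace Literature.NumberTheory.EllipticCurves

namespace BinaryQuartic

open Literature.MeasureTheory.Group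

variable (p : ℕ) [Fact p.Prime]

/-! ## §1 Haar measure of congruence classes -/

/-- The fibre of `toZModPow n : ℤ_p → ℤ/pⁿℤ` over `t` is the closed ball of radius `p⁻ⁿ` about the
standard lift `val t`. [folklore] -/
theorem toZModPow_eq_iff_norm_le (n : ℕ) (x : ℤ_[p]) (t : ZMod (p ^ n)) :
    PadicInt.toZModPow n x = t ↔ ‖x - ((t.val : ℕ) : ℤ_[p])‖ ≤ (p : ℝ) ^ (-(n : ℤ)) := by
  haveI : NeZero (p ^ n) := ⟨pow_ne_zero _ (Fact.out : p.Prime).ne_zero⟩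
  rw [PadicInt.norm_le_pow_iff_mem_span_pow, ← PadicInt.ker_toZModPow, RingHom.mem_ker, map_sub,
    map_natCast, ZMod.natCast_zmod_val, sub_eq_zero]

/-- The fibre of `toZModPow n` over `t` as a set: a closed ball of radius `p⁻ⁿ`. [folklore] -/
theorem preimage_toZModPow_singleton (n : ℕ) (t : ZMod (p ^ n)) :
    (PadicInt.toZModPow n : ℤ_[p] → ZMod (p ^ n)) ⁻¹' {t} =
      Metric.closedBall (((t.val : ℕ) : ℤ_[p])) ((p : ℝ) ^ (-(n : ℤ))) := by
  ext x
  rw [Set.mem_preimage, mem_singleton_iff, Metric.mem_closedBall, dist_eq_norm, toZModPow_eq_iff_norm_le]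

/-- **A congruence class modulo `pⁿ` in `ℤ_p^d` has measure `p^{-dn}`**: for `r ∈ (ℤ/pⁿℤ)^d`,
`vol{x ∈ ℤ_p^d : x mod pⁿ = r} = (p^{dn})⁻¹`. [folklore] -/
theorem volume_pi_setOf_toZModPow_eq {d : ℕ} (n : ℕ) (r : Fin d → ZMod (p ^ n)) :
    volume {x : Fin d → ℤ_[p] | (fun j => PadicInt.toZModPow n (x j)) = r} =
      ((p : ℝ≥0∞) ^ (d * n))⁻¹ := by
  have hset : {x : Fin d → ℤ_[p] | (fun j => PadicInt.toZModPow n (x j)) = r} =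
      Set.pi univ fun j => Metric.closedBall ((((r j).val : ℕ) : ℤ_[p])) ((p : ℝ) ^ (-(n : ℤ))) := by
    ext x
    simp only [mem_setOf_eq, mem_univ_pi, Metric.mem_closedBall, dist_eq_norm,
      ← toZModPow_eq_iff_norm_le, funext_iff]
  rw [hset, volume_pi_pi]
  simp only [padicInt_volume_closedBall, Finset.prod_const, Finset.card_univ, Fintype.card_fin]
  rw [← ENNReal.inv_pow, ← pow_mul, mul_comm, ENNReal.inv_pow]

/-- The congruence class is measurable. [folklore] -/
theorem measurableSet_pi_setOf_toZModPow_eq {d : ℕ} (n : ℕ) (r : Fin d → ZMod (p ^ n)) :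
    MeasurableSet {x : Fin d → ℤ_[p] | (fun j => PadicInt.toZModPow n (x j)) = r} := by
  have hset : {x : Fin d → ℤ_[p] | (fun j => PadicInt.toZModPow n (x j)) = r} =
      Set.pi univ fun j => Metric.closedBall ((((r j).val : ℕ) : ℤ_[p])) ((p : ℝ) ^ (-(n : ℤ))) := by
    ext x
    simp only [mem_setOf_eq, mem_univ_pi, Metric.mem_closedBall, dist_eq_norm,
      ← toZModPow_eq_iff_norm_le, funext_iff]
  rw [hset]
  exact MeasurableSet.univ_pi fun j => Metric.isClosed_closedBall.measurableSet

/-- `g ≡ f (mod pⁿ)` coefficientwise iff the coefficients have the same reductions modulo `pⁿ`.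
[folklore] -/
theorem forall_pow_dvd_sub_iff_toZModPow_eq (n : ℕ) (f g : BinaryQuartic ℤ_[p]) :
    (∀ i, (p : ℤ_[p]) ^ n ∣ g.coeffs i - f.coeffs i) ↔
      (fun j => PadicInt.toZModPow n (g.coeffs j)) = fun j => PadicInt.toZModPow n (f.coeffs j) := by
  rw [funext_iff]
  refine forall_congr' fun i => ?_
  rw [← Ideal.mem_span_singleton, ← PadicInt.ker_toZModPow, RingHom.mem_ker, map_sub, sub_eq_zero]

/-- **`μ_p(C_n(f)) = p^{-5n}`**: the congruence class of `f` modulo `pⁿ` in `V_{ℤ_p}` has measure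
`p^{-5n}`. [cite: BhargavaShankarAnnals2015, §2.5 (μ_p normalised, k·m⁻⁵; arXiv:1006.1002v2 numbering)] -/
theorem volume_setOf_congr (n : ℕ) (f : BinaryQuartic ℤ_[p]) :
    volume {g : BinaryQuartic ℤ_[p] | ∀ i, (p : ℤ_[p]) ^ n ∣ g.coeffs i - f.coeffs i} =
      ((p : ℝ≥0∞) ^ (5 * n))⁻¹ := by
  have hset : {g : BinaryQuartic ℤ_[p] | ∀ i, (p : ℤ_[p]) ^ n ∣ g.coeffs i - f.coeffs i} =
      coeffs ⁻¹' {x : Fin 5 → ℤ_[p] | (fun j => PadicInt.toZModPow n (x j)) =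
        fun j => PadicInt.toZModPow n (f.coeffs j)} := by
    ext g
    simp only [mem_setOf_eq, Set.mem_preimage, forall_pow_dvd_sub_iff_toZModPow_eq]
  rw [hset, ← measurableEquivFin5_apply]
  erw [(measurePreserving_measurableEquivFin5 (R := ℤ_[p])).measure_preimage
    (measurableSet_pi_setOf_toZModPow_eq p n _).nullMeasurableSet]
  exact volume_pi_setOf_toZModPow_eq p n _

/-- Real-valued form: `μ_p(C_n(f)) = (p^{5n})⁻¹`. [cite: BhargavaShankarAnnals2015, §2.5 (arXiv:1006.1002v2 numbering)] -/
theorem volume_real_setOf_congr (n : ℕ) (f : BinaryQuartic ℤ_[p]) :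
    volume.real {g : BinaryQuartic ℤ_[p] | ∀ i, (p : ℤ_[p]) ^ n ∣ g.coeffs i - f.coeffs i} =
      ((p : ℝ) ^ (5 * n))⁻¹ := by
  rw [measureReal_def, volume_setOf_congr, ENNReal.toReal_inv, ENNReal.toReal_pow, ENNReal.toReal_natCast]

/-! ## §2 Integrals of level-`n` functions are averages over `(ℤ/pⁿℤ)^d` -/

/-- A function of `x mod pⁿ` on `ℤ_p^d` is the finite sum of its values times the indicators of
the congruence classes. [folklore] -/
theorem comp_toZModPow_eq_sum_indicator {d : ℕ} (n : ℕ) (G : (Fin d → ZMod (p ^ n)) → ℝ)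
    (x : Fin d → ℤ_[p]) :
    G (fun j => PadicInt.toZModPow n (x j)) =
      ∑ r : Fin d → ZMod (p ^ n),
        {y : Fin d → ℤ_[p] | (fun j => PadicInt.toZModPow n (y j)) = r}.indicator (fun _ => G r) x := by
  haveI : NeZero (p ^ n) := ⟨pow_ne_zero _ (Fact.out : p.Prime).ne_zero⟩
  rw [Finset.sum_eq_single (fun j => PadicInt.toZModPow n (x j))]
  · rw [indicator_of_mem]
    exact rfl
  · intro r _ hr
    rw [indicator_of_notMem]
    exact fun h => hr h.symm
  · intro h
    exact absurd (Finset.mem_univ _) h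

/-- **Integral of a level-`n` function on `ℤ_p^d`**: for any `G` on `(ℤ/pⁿℤ)^d`,
`∫_{ℤ_p^d} G(x mod pⁿ) dx = (p^{dn})⁻¹ Σ_{r ∈ (ℤ/pⁿℤ)^d} G(r)` (Haar probability measure).
[cite: BhargavaShankarAnnals2015, §2.5, proof of Thm 2.11 (k·m⁻⁵ = ∏ μ_p(S); arXiv:1006.1002v2 numbering)] -/
theorem integral_comp_toZModPow_eq {d : ℕ} (n : ℕ) (G : (Fin d → ZMod (p ^ n)) → ℝ) :
    ∫ x : Fin d → ℤ_[p], G (fun j => PadicInt.toZModPow n (x j)) =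
      ((p : ℝ) ^ (d * n))⁻¹ * ∑ r : Fin d → ZMod (p ^ n), G r := by
  haveI : NeZero (p ^ n) := ⟨pow_ne_zero _ (Fact.out : p.Prime).ne_zero⟩
  simp_rw [comp_toZModPow_eq_sum_indicator p n G]
  rw [integral_finsetSum]
  · rw [Finset.mul_sum]
    refine Finset.sum_congr rfl fun r _ => ?_
    rw [integral_indicator_const _ (measurableSet_pi_setOf_toZModPow_eq p n r), smul_eq_mul,
      measureReal_def, volume_pi_setOf_toZModPow_eq, ENNReal.toReal_inv, ENNReal.toReal_pow,
      ENNReal.toReal_natCast]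
  · intro r _
    exact (integrable_const (G r)).indicator (measurableSet_pi_setOf_toZModPow_eq p n r)

/-- **Integral of a level-`n` function on `V_{ℤ_p}`**: for any `G` on `(ℤ/pⁿℤ)⁵`,
`∫_{V_{ℤ_p}} G(coeffs f mod pⁿ) dμ_p(f) = (p^{5n})⁻¹ Σ_{r ∈ (ℤ/pⁿℤ)⁵} G(r)`.
[cite: BhargavaShankarAnnals2015, §2.5, proof of Thm 2.11 (arXiv:1006.1002v2 numbering)] -/
theorem integral_comp_coeffs_toZModPow_eq (n : ℕ) (G : (Fin 5 → ZMod (p ^ n)) → ℝ) :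
    ∫ f : BinaryQuartic ℤ_[p], G (fun j => PadicInt.toZModPow n (f.coeffs j)) =
      ((p : ℝ) ^ (5 * n))⁻¹ * ∑ r : Fin 5 → ZMod (p ^ n), G r := by
  have h := (measurePreserving_measurableEquivFin5 (R := ℤ_[p])).integral_comp'
    (g := fun x : Fin 5 → ℤ_[p] => G (fun j => PadicInt.toZModPow n (x j)))
  simp only [measurableEquivFin5_apply] at h
  rw [h, integral_comp_toZModPow_eq]

/-- The form with coefficients the standard lifts of `r ∈ (ℤ/pⁿℤ)⁵` reduces to `r`. [folklore] -/
theorem toZModPow_coeffs_symm_val (n : ℕ) (r : Fin 5 → ZMod (p ^ n)) :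
    (fun j => PadicInt.toZModPow n
        ((equivFin5.symm fun i => (((r i).val : ℕ) : ℤ_[p])).coeffs j)) = r := by
  haveI : NeZero (p ^ n) := ⟨pow_ne_zero _ (Fact.out : p.Prime).ne_zero⟩
  funext j
  have hc : (equivFin5.symm fun i => (((r i).val : ℕ) : ℤ_[p])).coeffs j = (((r j).val : ℕ) : ℤ_[p]) :=
    congrFun (equivFin5.apply_symm_apply (fun i => (((r i).val : ℕ) : ℤ_[p]))) j
  rw [hc, map_natCast, ZMod.natCast_zmod_val]

/-- **`∫_{V_{ℤ_p}} ψ dμ_p = p^{-5n} Σ_{r mod pⁿ} ψ(r̃)` for a weight constant on congruence classes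
modulo `pⁿ`** (e.g. the envelopes `ψ_{p,n}`, `ψ'_{p,n}` of `BinaryQuarticCongruenceEnvelopesProofs`,
or the indicator of a set defined by congruence conditions modulo `pⁿ`, whose integral is its
density `μ_p`); `r̃` is the form whose coefficients are the standard lifts of `r ∈ (ℤ/pⁿℤ)⁵`.
[cite: BhargavaShankarAnnals2015, §2.5, proof of Thm 2.11 (k·m⁻⁵ = ∏ μ_p(S); arXiv:1006.1002v2 numbering)] -/
theorem integral_eq_of_congr_invariant (n : ℕ) (ψ : BinaryQuartic ℤ_[p] → ℝ)
    (hψ : ∀ f g : BinaryQuartic ℤ_[p], (∀ i, (p : ℤ_[p]) ^ n ∣ g.coeffs i - f.coeffs i) → ψ g = ψ f) :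
    ∫ f : BinaryQuartic ℤ_[p], ψ f =
      ((p : ℝ) ^ (5 * n))⁻¹ * ∑ r : Fin 5 → ZMod (p ^ n),
        ψ (equivFin5.symm fun i => (((r i).val : ℕ) : ℤ_[p])) := by
  set G : (Fin 5 → ZMod (p ^ n)) → ℝ := fun r => ψ (equivFin5.symm fun i => (((r i).val : ℕ) : ℤ_[p]))
    with hG
  have hfac : ∀ f : BinaryQuartic ℤ_[p], ψ f = G (fun j => PadicInt.toZModPow n (f.coeffs j)) := by
    intro f
    simp only [hG]
    refine (hψ _ _ ?_).symm
    rw [forall_pow_dvd_sub_iff_toZModPow_eq, toZModPow_coeffs_symm_val]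
  simp_rw [hfac]
  exact integral_comp_coeffs_toZModPow_eq p n G

/-! ## §3 The Chinese remainder product formula for averages -/

/-- **Chinese remainder for sums of products**: for pairwise coprime moduli `a_i` (`i` in a finite
index type), `N = ∏_i a_i`, and functions `G_i` on `(ℤ/a_iℤ)^d`,
`Σ_{r ∈ (ℤ/Nℤ)^d} ∏_i G_i(r mod a_i) = ∏_i Σ_{s ∈ (ℤ/a_iℤ)^d} G_i(s)`.
[cite: BhargavaShankarAnnals2015, §2.5, proof of Thm 2.11 ("the identity k·m⁻⁵ = ∏_p μ_p(S)"; arXiv:1006.1002v2 numbering)] -/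
theorem sum_prod_comp_castHom_eq_prod_sum {ι : Type*} [Fintype ι] (a : ι → ℕ) [∀ i, NeZero (a i)]
    [NeZero (∏ i, a i)] (coprime : Pairwise (Nat.Coprime on a)) {d : ℕ}
    (G : ∀ i, (Fin d → ZMod (a i)) → ℝ) :
    ∑ r : Fin d → ZMod (∏ i, a i),
        ∏ i, G i (fun j => ZMod.castHom (Finset.dvd_prod_of_mem a (Finset.mem_univ i)) (ZMod (a i)) (r j)) =
      ∏ i, ∑ s : Fin d → ZMod (a i), G i s := by
  -- reindex by `(ℤ/N)^d ≃ ∏_i (ℤ/a_i)^d`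
  let e₀ : ZMod (∏ i, a i) ≃ (∀ i, ZMod (a i)) := (ZMod.prodEquivPi a coprime).toEquiv
  let E : (Fin d → ZMod (∏ i, a i)) ≃ (∀ i, Fin d → ZMod (a i)) :=
    (Equiv.piCongrRight fun _ : Fin d => e₀).trans (Equiv.piComm fun _ i => ZMod (a i))
  have hE : ∀ r i j, E r i j = ZMod.castHom (Finset.dvd_prod_of_mem a (Finset.mem_univ i)) (ZMod (a i)) (r j) := by
    intro r i j
    simp only [E, e₀, Equiv.trans_apply, Equiv.piCongrRight_apply, Equiv.piComm_apply,
      Function.swap, Pi.map_apply, RingEquiv.toEquiv_eq_coe, EquivLike.coe_coe, ZMod.prodEquivPi_apply]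
  rw [Fintype.prod_sum]
  refine Fintype.sum_equiv E _ _ fun r => ?_
  refine Finset.prod_congr rfl fun i _ => ?_
  congr 1
  funext j
  exact (hE r i j).symm

/-- **The density of a product weight is the product of the local densities**
(the identity "`k m⁻⁵ = ∏_p μ_p(S)`"): with `N = ∏_i a_i` as above,
`N^{-d} Σ_{r ∈ (ℤ/Nℤ)^d} ∏_i G_i(r mod a_i) = ∏_i (a_i^{-d} Σ_{s ∈ (ℤ/a_iℤ)^d} G_i(s))`.
[cite: BhargavaShankarAnnals2015, §2.5, proof of Thm 2.11 (arXiv:1006.1002v2 numbering)] -/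
theorem density_prod_comp_castHom_eq_prod_density {ι : Type*} [Fintype ι] (a : ι → ℕ)
    [∀ i, NeZero (a i)] [NeZero (∏ i, a i)] (coprime : Pairwise (Nat.Coprime on a)) {d : ℕ}
    (G : ∀ i, (Fin d → ZMod (a i)) → ℝ) :
    (∑ r : Fin d → ZMod (∏ i, a i),
        ∏ i, G i (fun j => ZMod.castHom (Finset.dvd_prod_of_mem a (Finset.mem_univ i)) (ZMod (a i)) (r j))) /
        ((∏ i, a i : ℕ) : ℝ) ^ d =
      ∏ i, ((∑ s : Fin d → ZMod (a i), G i s) / ((a i : ℕ) : ℝ) ^ d) := by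
  rw [sum_prod_comp_castHom_eq_prod_sum a coprime G, Finset.prod_div_distrib]
  congr 1
  push_cast
  rw [Finset.prod_pow]

/-! ## §4 Glue for integral forms -/

/-- `(f ⊗ ℤ_p) mod pⁿ = f mod pⁿ` coefficientwise. [folklore] -/
theorem toZModPow_coeffs_map_intCast (n : ℕ) (f : BinaryQuartic ℤ) (j : Fin 5) :
    PadicInt.toZModPow n ((f.map (Int.castRingHom ℤ_[p])).coeffs j) = ((f.coeffs j : ℤ) : ZMod (p ^ n)) := by
  rw [coeffs_map, eq_intCast, map_intCast]

/-- `(f mod N) mod m = f mod m` coefficientwise, for `m ∣ N`. [folklore] -/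
theorem castHom_intCast_coeffs {N m : ℕ} (h : m ∣ N) (f : BinaryQuartic ℤ) (j : Fin 5) :
    ZMod.castHom h (ZMod m) ((f.coeffs j : ℤ) : ZMod N) = ((f.coeffs j : ℤ) : ZMod m) :=
  map_intCast _ _

/-- **The product weight on `V_ℤ` is a pull-back from `(ℤ/Nℤ)⁵`.** Let `a_i = p_i^{n_i}` for
distinct primes `p_i`, `N = ∏ a_i`, and let `ψ_i` be weights on `V_{ℤ_{p_i}}` of level `n_i`,
`ψ_i = G_i ∘ (· mod p_i^{n_i})`. Then for every integral form `f`,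
`∏_i ψ_i(f ⊗ ℤ_{p_i}) = Ψ(f mod N)` with `Ψ(r) = ∏_i G_i(r mod a_i)` — the weight to which the
residue-class count (`Literature.Algebra.EuclideanLattices.abs_sum_weight_sub_density_mul_volume_le`)
applies, with density `N⁻⁵ Σ_r Ψ(r) = ∏_i ∫ ψ_i dμ_{p_i}` by §2–§3.
[cite: BhargavaShankarAnnals2015, §2.5 Thm 2.11 and §2.7 (proof of Thm 2.21, published numbering)] -/
theorem prod_weight_map_intCast_eq {ι : Type*} [Fintype ι] (q : ι → ℕ) [∀ i, Fact (q i).Prime]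
    (k : ι → ℕ) [NeZero (∏ i, q i ^ k i)]
    (G : ∀ i, (Fin 5 → ZMod (q i ^ k i)) → ℝ) (f : BinaryQuartic ℤ) :
    ∏ i, G i (fun j => PadicInt.toZModPow (k i) ((f.map (Int.castRingHom ℤ_[q i])).coeffs j)) =
      ∏ i, G i (fun j => ZMod.castHom (Finset.dvd_prod_of_mem (fun i => q i ^ k i) (Finset.mem_univ i))
        (ZMod (q i ^ k i)) ((f.coeffs j : ℤ) : ZMod (∏ i, q i ^ k i))) := by
  refine Finset.prod_congr rfl fun i _ => ?_
  congr 1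
  funext j
  rw [toZModPow_coeffs_map_intCast, castHom_intCast_coeffs]

/-- Distinct primes give pairwise coprime prime powers (the hypothesis of §3 for `a_i = p_i^{n_i}`).
[folklore] -/
theorem pairwise_coprime_pow_of_injective {ι : Type*} (q : ι → ℕ) (hq : ∀ i, (q i).Prime)
    (hinj : Function.Injective q) (k : ι → ℕ) :
    Pairwise (Nat.Coprime on fun i => q i ^ k i) := by
  intro i j hij
  exact Nat.Coprime.pow _ _ ((Nat.coprime_primes (hq i) (hq j)).2 fun h => hij (hinj h))

end BinaryQuartic

end Literature.NumberTheory.EllipticCurves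

end
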